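import Literature.MathematicalPhysics.QuantumFieldTheory.BalabanImbrieJaffe1984to88.BIJ88Ineq593Proof

/-!
# `BalabanImbrieJaffe1984to88.BIJ88Restr592Proof` — T. Bałaban, J. Imbrie, A. Jaffe, *Effective action and cluster properties
of the abelian Higgs model*, Commun. Math. Phys. **114** (1988) 257–315 [BalabanImbrieJaffe1988], §5.9 *Bounds on Fluctuation
and Block Fields*, p. 296: **(5.9.2)** — *"bounds on φ and ψ − Q(u_k)φ imply that for y ∈ Λ₀^{(k)′}, |ψ(y)| ≦ cp(e_k)λ_k^{−1/4},
(L^kε)^d < λ; ||ψ(y)| − (8λ)^{−1/2}(L^kε)^{(d−2)/2}| ≦ cp(e_k)(L^kε)^{−1}, (L^kε)^d ≧ λ"* — PROVED as a MODEL INSTANCE of r16's typed leaf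
`BIJ88Sect5StatementsPart4.Restr592` on the concrete contour carrier of p36's `BIJ88Ineq593Proof`, with the explicit constant
`c = 2 + n_Γ`

statement-level skeleton of published theorems with citation tags; proofs where landed; nothing here is a claim about the Yang–Mills mass gap

PDF held: `paper:balaban1988-cmp114-bij-abelian-higgs-effective-action` (journal page = PDF page + 256).  Render read this
session as an image: p. 296 = PDF 40 (`HOME/lit-balaban-r16/renders/cmp114/original-p040-x2.png`).

CITATION HEADER (lean-in-tree rule).  Part of the lit-balaban TYPED SKELETON (HOME `run/shared/lean/pub/lit-balaban/`), row
**C2.Eq5.9.1-5.9.2** (`HOME/lit-balaban-r16/ROWS-C2-part2.md`, fold owner r16): (5.9.2) was TYPED as `Restr592` (p245624) and used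
so far only as a hypothesis (`BIJ88Ineq297.restr592_ball`, p02 gen 4).  Kind «model-instance»: the typed leaf is inhabited on the
carrier of `BIJ88Ineq593Proof` ((5.9.3), p36 gen 3), whose telescoping lemma and block-average model are used BY NAME.

**What the paper prints (p. 296 [PDF 40], verbatim).**  *"5.9. Bounds on Fluctuation and Block Fields.  As we remarked earlier, the
restrictions on u(p) and the gauge field renormalization transformations imply that |(1/ie_k) log v(p)| = |f(p)| ≦ cp(e_k),
p ∈ Λ₀^{(k)′**}. (5.9.1)  Also, bounds on φ and ψ − Q(u_k)φ imply that for y ∈ Λ₀^{(k)′},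
  |ψ(y)| ≦ cp(e_k)λ_k^{−1/4},   (L^kε)^d < λ,
  ||ψ(y)| − (8λ)^{−1/2}(L^kε)^{(d−2)/2}| ≦ cp(e_k)(L^kε)^{−1},   (L^kε)^d ≧ λ.   (5.9.2)"*
The *"bounds on φ and ψ − Q(u_k)φ"* are the restrictions (5.2.2) p. 278: `χ_y = χ(p(e_k), |(ψ − Q(u_k)φ)(y)|)`, `χ_x = χ(·, |φ(x)|)` resp.
`χ(·, ||φ(x)| − (8λ)^{−1/2}(L^kε)^{(d−2)/2}|)` in the two regimes, `χ_b = χ(p(e_k), |(D_{ū_k}φ)(b)|)`.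

**The model (p36's carrier, exactly).**  `u : PBond P j → ℂ` unimodular on the torus `T_η` of `Balaban1983to89.Setup`; the fine field
`φ : Site P j → ℂ`; coarse sites `κ` (for the leaf: `κ = Site P j′`, the block lattice carrying `Λ₀^{(k)′}`), the block field `ψ : κ → ℂ`;
blocks `B(y) ⊂ T_η` with `|B(y)|·w = 1`, base points `base y`, the contours `Γ_{y,x}` of [2] Chap. 2 as `IsPath` data with lengths
`≤ n_Γ`; `(Q(u)φ)(y) = Σ_{x∈B(y)} w·u(Γ_{y,x})φ(x)` (`BIJ88Sect5StatementsPart4.covAvg`); `D_uφ(b) = BIJ88Sect3Statements.covD 1 u φ b`.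
HYPOTHESES = the restrictions, in the shape they are printed: `|ψ(y) − (Q(u)φ)(y)| ≤ p(e_k)` on `Λ₀′` (`χ_y`); small-λ regime:
`|φ(x)| ≤ p(e_k)λ_k^{−1/4}` on the blocks over `Λ₀′` (the `χ_x` radius in the shape (5.9.2) displays — r16's transcript note T10 records
that (5.2.2) prints the radius «λ_kp(e_k)»; taken here as a hypothesis, not adjudicated); large-λ regime: `||φ(base y)| − ρ₀| ≤
p(e_k)(L^kε)^{−1}`, `ρ₀ = (8λ)^{−1/2}(L^kε)^{(d−2)/2}`, and `|D_uφ| ≤ p(e_k)` on the bonds of the contours (`χ_b`); `0 < L^kε ≤ 1`, `0 < λ_k ≤ 1`.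

**What is kernel-checked (zero `sorry`, standard axioms, no new named facts).**
 * `norm_covAvg_le` — `|Q(u)φ(y)| ≤ max_{B(y)} |φ|` (unimodular transporters, `Σw = 1`);
 * `covAvg_sub_const`, **`norm_covAvg_sub_base_le`** — `|Q(u)φ(y) − φ(base y)| ≤ n_Γ·δ` from `|D_uφ| ≤ δ` on the contours, by p36's
   covariant telescoping lemma `norm_transport_mul_sub_le`;
 * `norm_psi_le` (small-λ mechanism: `|ψ(y)| ≤ p₁ + R`), `abs_norm_psi_sub_le` (large-λ mechanism: `||ψ(y)| − ρ₀| ≤ p₁ + n_Γδ + δ₀`);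
 * **`restr592_of_restrictions : Restr592 (2 + n_Γ) p(e_k) λ_k λ (L^kε) d Λ₀′ ψ`** — (5.9.2) AS TYPED, both regimes, `c = 2 + n_Γ`
   (`n_Γ = O(dL)`: the contours of [2] have length `O(dL)`).
**Not claimed.**  (5.9.1) (= r16's `SmallF`, proved on the torus by p31's `BIJ88Eq531SmallF`); the construction of the contours; anything
of B1–B16.  NOT summit progress; NOT continuum; NOT Clay.  Imports Literature only; no Summits import; modifies nothing.  Cell
`lit-balaban` Phase 2, seat p02 gen 6.
-/

namespace Literature.MathematicalPhysics.QuantumFieldTheory.BalabanImbrieJaffe1984to88.BIJ88Restr592Proof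

open Literature.MathematicalPhysics.QuantumFieldTheory.Balaban1983to89
open BIJ88Sect3Statements BIJ88Sect5StatementsPart4 BIJ88Ineq593Proof
open Complex

variable {P : Params} {j : ℕ} {κ : Type*}

/-! ## §1 The covariant block average: size and distance to the base-point value -/

/-- **`|Q(u)φ(y)| ≤ max_{B(y)}|φ|`**: with unimodular transporters and weights summing to one, the block average is bounded by the
bound on `φ` over the block. [cite: BalabanImbrieJaffe1988, (5.9.2) p.296] -/
theorem norm_covAvg_le (u : PBond P j → ℂ) (hu : ∀ b, ‖u b‖ = 1) (φ : Balaban1983to89.Site P j → ℂ)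
    (B : κ → Finset (Balaban1983to89.Site P j)) (w : ℝ) (hw : 0 ≤ w) (Γ : κ → Balaban1983to89.Site P j → Contour P j) {y : κ}
    (hBy : ((B y).card : ℝ) * w = 1) {R : ℝ} (hφ : ∀ x ∈ B y, ‖φ x‖ ≤ R) :
    ‖covAvg B w (fun z x => transport u (Γ z x)) φ y‖ ≤ R := by
  unfold covAvg
  calc ‖∑ x ∈ B y, (w : ℂ) * transport u (Γ y x) * φ x‖
      ≤ ∑ x ∈ B y, ‖(w : ℂ) * transport u (Γ y x) * φ x‖ := norm_sum_le _ _
    _ ≤ ∑ x ∈ B y, w * R := by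
        refine Finset.sum_le_sum fun x hx => ?_
        rw [norm_mul, norm_mul, Complex.norm_real, Real.norm_of_nonneg hw, norm_transport u hu, mul_one]
        exact mul_le_mul_of_nonneg_left (hφ x hx) hw
    _ = R := by rw [Finset.sum_const, nsmul_eq_mul, ← mul_assoc, hBy, one_mul]

/-- `Q(u)φ(y) − c = Σ_{x∈B(y)} w·(u(Γ_{y,x})φ(x) − c)` when `|B(y)|·w = 1`. [cite: BalabanImbrieJaffe1988, (5.9.2) p.296] -/
theorem covAvg_sub_const (u : PBond P j → ℂ) (φ : Balaban1983to89.Site P j → ℂ) (B : κ → Finset (Balaban1983to89.Site P j)) (w : ℝ)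
    (Γ : κ → Balaban1983to89.Site P j → Contour P j) {y : κ} (hBy : ((B y).card : ℝ) * w = 1) (c : ℂ) :
    covAvg B w (fun z x => transport u (Γ z x)) φ y - c = ∑ x ∈ B y, (w : ℂ) * (transport u (Γ y x) * φ x - c) := by
  have hBy' : ((B y).card : ℂ) * (w : ℂ) = 1 := by exact_mod_cast hBy
  unfold covAvg
  rw [Finset.sum_congr rfl fun x _ => mul_sub (w : ℂ) (transport u (Γ y x) * φ x) c, Finset.sum_sub_distrib, Finset.sum_const,
    nsmul_eq_mul, ← mul_assoc, hBy', one_mul]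
  congr 1
  exact Finset.sum_congr rfl fun x _ => by ring

/-- **`|Q(u)φ(y) − φ(base y)| ≤ n_Γ·δ`**: if `|D_uφ| ≤ δ` on every bond of the contours `Γ_{y,x}` (`x ∈ B(y)`, lengths `≤ n_Γ`), the
block average differs from the value at the base point by at most `n_Γδ` — p36's covariant telescoping lemma along each contour,
averaged. [cite: BalabanImbrieJaffe1988, (5.9.2) p.296] -/
theorem norm_covAvg_sub_base_le (u : PBond P j → ℂ) (hu : ∀ b, ‖u b‖ = 1) (φ : Balaban1983to89.Site P j → ℂ)
    (B : κ → Finset (Balaban1983to89.Site P j)) (w : ℝ) (hw : 0 ≤ w) (base : κ → Balaban1983to89.Site P j)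
    (Γ : κ → Balaban1983to89.Site P j → Contour P j) {y : κ} (hBy : ((B y).card : ℝ) * w = 1)
    (hΓ : ∀ x ∈ B y, IsPath (base y) (Γ y x) x) {nΓ : ℕ} (hlen : ∀ x ∈ B y, (Γ y x).length ≤ nΓ) {δ : ℝ} (hδ : 0 ≤ δ)
    (hD : ∀ x ∈ B y, ∀ s ∈ Γ y x, ‖covD 1 u φ s.1‖ ≤ δ) :
    ‖covAvg B w (fun z x => transport u (Γ z x)) φ y - φ (base y)‖ ≤ nΓ * δ := by
  rw [covAvg_sub_const u φ B w Γ hBy]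
  have hx : ∀ x ∈ B y, ‖transport u (Γ y x) * φ x - φ (base y)‖ ≤ nΓ * δ := by
    intro x hx
    have htel := norm_transport_mul_sub_le u hu φ (Γ y x) (base y) x (hΓ x hx)
    have hsum := List.sum_le_card_nsmul ((Γ y x).map fun s => ‖covD 1 u φ s.1‖) δ (by
      intro a ha
      obtain ⟨s, hs, rfl⟩ := List.mem_map.mp ha
      exact hD x hx s hs)
    rw [List.length_map, nsmul_eq_mul] at hsum
    refine htel.trans (hsum.trans ?_)
    have : ((Γ y x).length : ℝ) ≤ nΓ := by exact_mod_cast hlen x hx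
    exact mul_le_mul_of_nonneg_right this hδ
  calc ‖∑ x ∈ B y, (w : ℂ) * (transport u (Γ y x) * φ x - φ (base y))‖
      ≤ ∑ x ∈ B y, ‖(w : ℂ) * (transport u (Γ y x) * φ x - φ (base y))‖ := norm_sum_le _ _
    _ ≤ ∑ x ∈ B y, w * (nΓ * δ) := by
        refine Finset.sum_le_sum fun x hx' => ?_
        rw [norm_mul, Complex.norm_real, Real.norm_of_nonneg hw]
        exact mul_le_mul_of_nonneg_left (hx x hx') hw
    _ = nΓ * δ := by rw [Finset.sum_const, nsmul_eq_mul, ← mul_assoc, hBy, one_mul]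

/-! ## §2 The two mechanisms -/

/-- **small-λ mechanism**: `|ψ(y)| ≤ |ψ(y) − Q(u)φ(y)| + |Q(u)φ(y)| ≤ p₁ + R`. [cite: BalabanImbrieJaffe1988, (5.9.2) p.296] -/
theorem norm_psi_le (u : PBond P j → ℂ) (hu : ∀ b, ‖u b‖ = 1) (φ : Balaban1983to89.Site P j → ℂ)
    (B : κ → Finset (Balaban1983to89.Site P j)) (w : ℝ) (hw : 0 ≤ w) (Γ : κ → Balaban1983to89.Site P j → Contour P j)
    (ψ : κ → ℂ) {y : κ} (hBy : ((B y).card : ℝ) * w = 1) {p₁ R : ℝ}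
    (hψ : ‖ψ y - covAvg B w (fun z x => transport u (Γ z x)) φ y‖ ≤ p₁) (hφ : ∀ x ∈ B y, ‖φ x‖ ≤ R) :
    ‖ψ y‖ ≤ p₁ + R := by
  have hQ := norm_covAvg_le u hu φ B w hw Γ hBy hφ
  calc ‖ψ y‖ = ‖(ψ y - covAvg B w (fun z x => transport u (Γ z x)) φ y) + covAvg B w (fun z x => transport u (Γ z x)) φ y‖ := by
        rw [sub_add_cancel]
    _ ≤ p₁ + R := (norm_add_le _ _).trans (add_le_add hψ hQ)

/-- **large-λ mechanism**: `||ψ(y)| − ρ₀| ≤ |ψ(y) − Q(u)φ(y)| + |Q(u)φ(y) − φ(base y)| + ||φ(base y)| − ρ₀| ≤ p₁ + n_Γδ + δ₀`.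
[cite: BalabanImbrieJaffe1988, (5.9.2) p.296] -/
theorem abs_norm_psi_sub_le (u : PBond P j → ℂ) (hu : ∀ b, ‖u b‖ = 1) (φ : Balaban1983to89.Site P j → ℂ)
    (B : κ → Finset (Balaban1983to89.Site P j)) (w : ℝ) (hw : 0 ≤ w) (base : κ → Balaban1983to89.Site P j)
    (Γ : κ → Balaban1983to89.Site P j → Contour P j) (ψ : κ → ℂ) {y : κ} (hBy : ((B y).card : ℝ) * w = 1)
    (hΓ : ∀ x ∈ B y, IsPath (base y) (Γ y x) x) {nΓ : ℕ} (hlen : ∀ x ∈ B y, (Γ y x).length ≤ nΓ) {p₁ δ δ₀ ρ₀ : ℝ} (hδ : 0 ≤ δ)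
    (hψ : ‖ψ y - covAvg B w (fun z x => transport u (Γ z x)) φ y‖ ≤ p₁)
    (hD : ∀ x ∈ B y, ∀ s ∈ Γ y x, ‖covD 1 u φ s.1‖ ≤ δ) (hφ₀ : |‖φ (base y)‖ - ρ₀| ≤ δ₀) :
    |‖ψ y‖ - ρ₀| ≤ p₁ + nΓ * δ + δ₀ := by
  set Q : ℂ := covAvg B w (fun z x => transport u (Γ z x)) φ y with hQ
  have hQb : ‖Q - φ (base y)‖ ≤ nΓ * δ := norm_covAvg_sub_base_le u hu φ B w hw base Γ hBy hΓ hlen hδ hD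
  have h1 : ‖ψ y - φ (base y)‖ ≤ p₁ + nΓ * δ := by
    calc ‖ψ y - φ (base y)‖ = ‖(ψ y - Q) + (Q - φ (base y))‖ := by rw [sub_add_sub_cancel]
      _ ≤ p₁ + nΓ * δ := (norm_add_le _ _).trans (add_le_add hψ hQb)
  have h2 : |‖ψ y‖ - ‖φ (base y)‖| ≤ ‖ψ y - φ (base y)‖ := abs_norm_sub_norm_le _ _
  have h3 : |‖ψ y‖ - ρ₀| ≤ |‖ψ y‖ - ‖φ (base y)‖| + |‖φ (base y)‖ - ρ₀| := by
    have := abs_sub_le ‖ψ y‖ ‖φ (base y)‖ ρ₀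
    exact this
  linarith

/-! ## §3 (5.9.2) as the typed leaf `Restr592` -/

/-- **(5.9.2)** p. 296 [PDF 40], verbatim: *"Also, bounds on φ and ψ − Q(u_k)φ imply that for y ∈ Λ₀^{(k)′}, |ψ(y)| ≦ cp(e_k)λ_k^{−1/4},
(L^kε)^d < λ, ||ψ(y)| − (8λ)^{−1/2}(L^kε)^{(d−2)/2}| ≦ cp(e_k)(L^kε)^{−1}, (L^kε)^d ≧ λ. (5.9.2)"* — PROVED as a MODEL INSTANCE of r16's
`Restr592` with `c = 2 + n_Γ`: block lattice `κ = Site P j′` carrying `Λ₀′`, blocks `B(y) ⊂ T_η` with `|B|·w = 1`, contours `Γ_{y,x}`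
(`IsPath`, lengths `≤ n_Γ`), `Q(u)φ` = `covAvg`; HYPOTHESES = the restrictions (5.2.2): `|ψ − Q(u)φ| ≤ p(e_k)` on `Λ₀′` (`χ_y`), in the
regime `(L^kε)^d < λ` the bound `|φ(x)| ≤ p(e_k)λ_k^{−1/4}` on the blocks over `Λ₀′` (`χ_x`), in the regime `(L^kε)^d ≥ λ` the bounds
`||φ(base y)| − (8λ)^{−1/2}(L^kε)^{(d−2)/2}| ≤ p(e_k)(L^kε)^{−1}` (`χ_x`) and `|D_uφ| ≤ p(e_k)` on the contours (`χ_b`); `0 < L^kε ≤ 1`,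
`0 < λ_k ≤ 1`. [cite: BalabanImbrieJaffe1988, (5.9.2) p.296] -/
theorem restr592_of_restrictions {j' : ℕ} (u : PBond P j → ℂ) (hu : ∀ b, ‖u b‖ = 1) (φ : Balaban1983to89.Site P j → ℂ)
    (B : Balaban1983to89.Site P j' → Finset (Balaban1983to89.Site P j)) (w : ℝ) (hw : 0 ≤ w)
    (base : Balaban1983to89.Site P j' → Balaban1983to89.Site P j)
    (Γ : Balaban1983to89.Site P j' → Balaban1983to89.Site P j → Contour P j) (ψ : Balaban1983to89.Site P j' → ℂ)
    (Λ0' : Finset (Balaban1983to89.Site P j')) {pek lamk lam s : ℝ} {d nΓ : ℕ} (hpek : 0 ≤ pek)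
    (hs : 0 < s) (hs1 : s ≤ 1) (hlamk : 0 < lamk) (hlamk1 : lamk ≤ 1)
    (hB : ∀ y ∈ Λ0', ((B y).card : ℝ) * w = 1)
    (hΓ : ∀ y ∈ Λ0', ∀ x ∈ B y, IsPath (base y) (Γ y x) x) (hlen : ∀ y ∈ Λ0', ∀ x ∈ B y, (Γ y x).length ≤ nΓ)
    (hψ : ∀ y ∈ Λ0', ‖ψ y - covAvg B w (fun z x => transport u (Γ z x)) φ y‖ ≤ pek)
    (hφsmall : s ^ d < lam → ∀ y ∈ Λ0', ∀ x ∈ B y, ‖φ x‖ ≤ pek * lamk ^ (-(1 / 4 : ℝ)))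
    (hφlarge : lam ≤ s ^ d → ∀ y ∈ Λ0', |‖φ (base y)‖ - (8 * lam) ^ (-(1 / 2 : ℝ)) * s ^ (((d : ℝ) - 2) / 2)| ≤ pek * s⁻¹)
    (hD : lam ≤ s ^ d → ∀ y ∈ Λ0', ∀ x ∈ B y, ∀ sg ∈ Γ y x, ‖covD 1 u φ sg.1‖ ≤ pek) :
    Restr592 (2 + nΓ) pek lamk lam s d Λ0' ψ := by
  refine ⟨fun hreg y hy => ?_, fun hreg y hy => ?_⟩
  · -- regime (L^kε)^d < λ
    have h1 : ‖ψ y‖ ≤ pek + pek * lamk ^ (-(1 / 4 : ℝ)) :=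
      norm_psi_le u hu φ B w hw Γ ψ (hB y hy) (hψ y hy) (hφsmall hreg y hy)
    have hpow : 1 ≤ lamk ^ (-(1 / 4 : ℝ)) := by
      rw [Real.rpow_neg hlamk.le]
      exact one_le_inv_iff₀.2 ⟨Real.rpow_pos_of_pos hlamk _, Real.rpow_le_one hlamk.le hlamk1 (by norm_num)⟩
    have hpow0 : 0 ≤ lamk ^ (-(1 / 4 : ℝ)) := Real.rpow_nonneg hlamk.le _
    have hnΓ : (0 : ℝ) ≤ nΓ := Nat.cast_nonneg nΓ
    have h2 : pek ≤ pek * lamk ^ (-(1 / 4 : ℝ)) := by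
      have := mul_le_mul_of_nonneg_left hpow hpek
      rwa [mul_one] at this
    nlinarith
  · -- regime (L^kε)^d ≥ λ
    have h1 : |‖ψ y‖ - (8 * lam) ^ (-(1 / 2 : ℝ)) * s ^ (((d : ℝ) - 2) / 2)| ≤ pek + nΓ * pek + pek * s⁻¹ :=
      abs_norm_psi_sub_le u hu φ B w hw base Γ ψ (hB y hy) (hΓ y hy) (hlen y hy) hpek (hψ y hy) (hD hreg y hy)
        (hφlarge hreg y hy)
    have hinv : 1 ≤ s⁻¹ := one_le_inv_iff₀.2 ⟨hs, hs1⟩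
    have hnΓ : (0 : ℝ) ≤ nΓ := Nat.cast_nonneg nΓ
    have h2 : pek + nΓ * pek ≤ (pek + nΓ * pek) * s⁻¹ := by
      have := mul_le_mul_of_nonneg_left hinv (by positivity : 0 ≤ pek + nΓ * pek)
      rwa [mul_one] at this
    nlinarith

/-! ## §4 (v1.1, append-only) p. 297: *"These bounds allow us to insert the following characteristic functions … and the integral is
unchanged"* — the kernel sense, for r16's typed `chiNext` -/

open BIJ88Sect5Statements

/-- monotonicity of the typed leaf in the constant: `Restr592 c₁ ⇒ Restr592 c₂` for `c₁ ≤ c₂` (`p(e_k) ≥ 0`, `λ_k ≥ 0`, `L^kε > 0`).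
[cite: BalabanImbrieJaffe1988, (5.9.2) p.296] -/
theorem restr592_mono {c₁ c₂ pek lamk lam s : ℝ} {d : ℕ} {Λ0' : Finset (Balaban1983to89.Site P j)}
    {ψ : Balaban1983to89.Site P j → ℂ} (hc : c₁ ≤ c₂) (hpek : 0 ≤ pek) (hlamk : 0 ≤ lamk) (hs : 0 < s)
    (h : Restr592 c₁ pek lamk lam s d Λ0' ψ) : Restr592 c₂ pek lamk lam s d Λ0' ψ := by
  refine ⟨fun hreg y hy => (h.1 hreg y hy).trans ?_, fun hreg y hy => (h.2 hreg y hy).trans ?_⟩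
  · exact mul_le_mul_of_nonneg_right (mul_le_mul_of_nonneg_right hc hpek) (Real.rpow_nonneg hlamk _)
  · exact mul_le_mul_of_nonneg_right (mul_le_mul_of_nonneg_right hc hpek) (inv_pos.2 hs).le

/-- **p. 297** [PDF 41], verbatim: *"These bounds allow us to insert the following characteristic functions: χ_{k+1,Λ₀^{(k)′}} =
Π_{p∈Λ₀^{(k)′**}} χ(ce_kp(e_k), |v(p) − 1|) × Π_{y∈Λ₀^{(k)′}} χ(cp(e_k)λ_k^{−1/4}, |ψ(y)|) Π_{b∈Λ₀^{(k)′*}} χ(cp(e_k), |(D_{ū_{k+1}}ψ)(b)|) and the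
integral is unchanged. If (L^kε)^d ≧ λ, the bound on ψ is replaced with χ(cp(e_k)(L^kε)^{−1}, ||ψ(y)| − (8λ)^{−1/2}(L^kε)^{(d−2)/2}|)."* — the
KERNEL SENSE of *"the integral is unchanged"* (as r16's `chiPrime7_eq_one` for `χ′_{Λ₇}`): on configurations obeying the three bounds
STRICTLY INSIDE THE PLATEAU of the profile (5.2.3) — `|v(p) − 1| ≤ (9/10)ce_kp(e_k)` on `Λ₀′**`, (5.9.2) with constant `(9/10)c` on `Λ₀′`
(both regimes), `|D_{ū_{k+1}}ψ| ≤ (9/10)cp(e_k)` on `Λ₀′*`, all radii positive — the inserted factor `χ_{k+1,Λ₀^{(k)′}}` (`chiNext`) equals `1`.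
[cite: BalabanImbrieJaffe1988, (5.9.3) p.297] -/
theorem chiNext_eq_one (χ : CutoffProfile) {c ek pek lamk lam s : ℝ} {d : ℕ} (hc : 0 < c) (hek : 0 < ek) (hpek : 0 < pek)
    (hlamk : 0 < lamk) (hs : 0 < s) (X : Finset (Balaban1983to89.Site P j)) {v : Plaq P j → ℂ}
    {ψ : Balaban1983to89.Site P j → ℂ} {ubar : PBond P j → ℂ} (hv : ∀ p ∈ starP X, ‖v p - 1‖ ≤ 9 / 10 * (c * ek * pek))
    (hψ : Restr592 (9 / 10 * c) pek lamk lam s d X ψ) (hD : ∀ b ∈ starB X, ‖covD 1 ubar ψ b‖ ≤ 9 / 10 * (c * pek)) :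
    chiNext χ c ek pek lamk lam s d X v ψ ubar = 1 := by
  have hcp : 0 < c * pek := mul_pos hc hpek
  have hcep : 0 < c * ek * pek := mul_pos (mul_pos hc hek) hpek
  unfold chiNext
  rw [Finset.prod_eq_one fun p hp => cutoff_eq_one χ hcep (by rw [abs_norm]; exact hv p hp),
    Finset.prod_eq_one fun b hb => cutoff_eq_one χ hcp (by rw [abs_norm]; exact hD b hb), one_mul, mul_one]
  refine Finset.prod_eq_one fun y hy => ?_
  split_ifs with hreg
  · refine cutoff_eq_one χ (mul_pos hcp (Real.rpow_pos_of_pos hlamk _)) ?_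
    rw [abs_norm]
    have := hψ.1 hreg y hy
    linarith
  · refine cutoff_eq_one χ (mul_pos hcp (inv_pos.2 hs)) ?_
    have := hψ.2 (not_lt.mp hreg) y hy
    linarith

/-- p. 297, the insertion sentence ON THE MODEL of §3: from the restrictions (hypotheses of `restr592_of_restrictions`) and the `v`,
`D_{ū_{k+1}}ψ` bounds strictly inside the plateau, `χ_{k+1,Λ₀^{(k)′}} = 1` for every constant `c ≥ (10/9)(2 + n_Γ)`.
[cite: BalabanImbrieJaffe1988, (5.9.3) p.297] -/
theorem chiNext_eq_one_of_restrictions (χ : CutoffProfile) {j' : ℕ} (u : PBond P j → ℂ) (hu : ∀ b, ‖u b‖ = 1)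
    (φ : Balaban1983to89.Site P j → ℂ) (B : Balaban1983to89.Site P j' → Finset (Balaban1983to89.Site P j)) (w : ℝ) (hw : 0 ≤ w)
    (base : Balaban1983to89.Site P j' → Balaban1983to89.Site P j)
    (Γ : Balaban1983to89.Site P j' → Balaban1983to89.Site P j → Contour P j) (ψ : Balaban1983to89.Site P j' → ℂ)
    (Λ0' : Finset (Balaban1983to89.Site P j')) {c ek pek lamk lam s : ℝ} {d nΓ : ℕ} (hc : 10 / 9 * (2 + nΓ) ≤ c) (hek : 0 < ek)
    (hpek : 0 < pek) (hs : 0 < s) (hs1 : s ≤ 1) (hlamk : 0 < lamk) (hlamk1 : lamk ≤ 1)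
    (hB : ∀ y ∈ Λ0', ((B y).card : ℝ) * w = 1)
    (hΓ : ∀ y ∈ Λ0', ∀ x ∈ B y, IsPath (base y) (Γ y x) x) (hlen : ∀ y ∈ Λ0', ∀ x ∈ B y, (Γ y x).length ≤ nΓ)
    (hψ : ∀ y ∈ Λ0', ‖ψ y - covAvg B w (fun z x => transport u (Γ z x)) φ y‖ ≤ pek)
    (hφsmall : s ^ d < lam → ∀ y ∈ Λ0', ∀ x ∈ B y, ‖φ x‖ ≤ pek * lamk ^ (-(1 / 4 : ℝ)))
    (hφlarge : lam ≤ s ^ d → ∀ y ∈ Λ0', |‖φ (base y)‖ - (8 * lam) ^ (-(1 / 2 : ℝ)) * s ^ (((d : ℝ) - 2) / 2)| ≤ pek * s⁻¹)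
    (hD : lam ≤ s ^ d → ∀ y ∈ Λ0', ∀ x ∈ B y, ∀ sg ∈ Γ y x, ‖covD 1 u φ sg.1‖ ≤ pek)
    {v : Plaq P j' → ℂ} {ubar : PBond P j' → ℂ} (hv : ∀ p ∈ starP Λ0', ‖v p - 1‖ ≤ 9 / 10 * (c * ek * pek))
    (hDψ : ∀ b ∈ starB Λ0', ‖covD 1 ubar ψ b‖ ≤ 9 / 10 * (c * pek)) :
    chiNext χ c ek pek lamk lam s d Λ0' v ψ ubar = 1 := by
  have hnΓ : (0 : ℝ) ≤ nΓ := Nat.cast_nonneg nΓ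
  have hc0 : 0 < c := lt_of_lt_of_le (by positivity) hc
  have h592 := restr592_of_restrictions u hu φ B w hw base Γ ψ Λ0' hpek.le hs hs1 hlamk hlamk1 hB hΓ hlen hψ hφsmall hφlarge hD
  exact chiNext_eq_one χ hc0 hek hpek hlamk hs Λ0' hv (restr592_mono (by linarith) hpek.le hlamk.le hs h592) hDψ

/-! ## §5 (v1.2, append-only) ON THE SUPPORT of the (5.2.2) characteristic functions the hypotheses of §3 hold: the printed
chain *"(5.2.2) [in the integrand (5.2.8)] ⇒ bounds on φ and ψ − Q(u_k)φ ⇒ (5.9.2)"* in kernel form, for r16's typed `chiX`, `chiY`, `chiB` -/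

open BIJ88Sect5StatementsPart3

/-- support of the scaled cut-off (5.2.4): `χ(p, x) ≠ 0`, `p > 0` ⇒ `|x| < p` (contrapositive of `BIJ88Sect5Statements.cutoff_eq_zero`,
*"equal to zero for |x| ≥ 1"*). [cite: BalabanImbrieJaffe1988, (5.2.4) p.278] -/
theorem abs_lt_of_cutoff_ne_zero (χ : CutoffProfile) {p x : ℝ} (hp : 0 < p) (h : cutoff χ p x ≠ 0) : |x| < p := by
  by_contra hx
  exact h (cutoff_eq_zero χ hp (not_lt.mp hx))

/-- on the support of `χ_y = χ(p(e_k), |(ψ − Q(u_k)φ)(y)|)` ((5.2.2)): `|ψ(y) − (Q(u_k)φ)(y)| < p(e_k)`. [cite: BalabanImbrieJaffe1988, (5.2.2) p.278] -/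
theorem norm_sub_lt_of_chiY_ne_zero (χ : CutoffProfile) {pek : ℝ} (hpek : 0 < pek) {ψy Qφy : ℂ} (h : chiY χ pek ψy Qφy ≠ 0) :
    ‖ψy - Qφy‖ < pek := by
  have := abs_lt_of_cutoff_ne_zero χ hpek (by simpa [chiY] using h)
  rwa [abs_norm] at this

/-- on the support of `χ_b = χ(p(e_k), |(D_ūφ)(b)|)` ((5.2.2)): `|(D_ūφ)(b)| < p(e_k)`. [cite: BalabanImbrieJaffe1988, (5.2.2) p.278] -/
theorem norm_covD_lt_of_chiB_ne_zero (χ : CutoffProfile) {pek : ℝ} (hpek : 0 < pek) {ubar : PBond P j → ℂ}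
    {φ : Balaban1983to89.Site P j → ℂ} {b : PBond P j} (h : chiB χ pek ubar φ b ≠ 0) : ‖covD 1 ubar φ b‖ < pek := by
  have := abs_lt_of_cutoff_ne_zero χ hpek (by simpa [chiB] using h)
  rwa [abs_norm] at this

/-- on the support of `χ_x` ((5.2.2)) in the regime `(L^kε)^d < λ`, with the radius parameter instantiated `lamk ↦ λ_k^{−1/4}` (r16's
transcription note T10 on `chiX`: printed `λ_kp(e_k)`, meant `λ_k^{−1/4}p(e_k)` as in (4.5)/(5.9.2); `chiX` leaves it free): `|φ(x)| <
p(e_k)λ_k^{−1/4}`. [cite: BalabanImbrieJaffe1988, (5.2.2) p.278] -/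
theorem norm_lt_of_chiX_ne_zero (χ : CutoffProfile) {r pek s lam : ℝ} {d : ℕ} (hr : 0 < r) (hpek : 0 < pek) (hreg : s ^ d < lam)
    {φx : ℂ} (h : chiX χ r pek s lam d φx ≠ 0) : ‖φx‖ < pek * r := by
  have h' : cutoff χ (r * pek) ‖φx‖ ≠ 0 := by simpa [chiX, hreg] using h
  have := abs_lt_of_cutoff_ne_zero χ (mul_pos hr hpek) h'
  rwa [abs_norm, mul_comm] at this

/-- on the support of `χ_x` ((5.2.2)) in the regime `(L^kε)^d ≥ λ`: `||φ(x)| − (8λ)^{−1/2}(L^kε)^{(d−2)/2}| < p(e_k)(L^kε)^{−1}`.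
[cite: BalabanImbrieJaffe1988, (5.2.2) p.278] -/
theorem abs_norm_sub_lt_of_chiX_ne_zero (χ : CutoffProfile) {r pek s lam : ℝ} {d : ℕ} (hs : 0 < s) (hpek : 0 < pek)
    (hreg : lam ≤ s ^ d) {φx : ℂ} (h : chiX χ r pek s lam d φx ≠ 0) :
    |‖φx‖ - (8 * lam) ^ (-(1 / 2 : ℝ)) * s ^ (((d : ℝ) - 2) / 2)| < pek * s⁻¹ := by
  have h' : cutoff χ (s⁻¹ * pek) (‖φx‖ - (8 * lam) ^ (-(1 / 2 : ℝ)) * s ^ (((d : ℝ) - 2) / 2)) ≠ 0 := by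
    simpa [chiX, not_lt.mpr hreg] using h
  have := abs_lt_of_cutoff_ne_zero χ (mul_pos (inv_pos.2 hs) hpek) h'
  rwa [mul_comm s⁻¹ pek] at this

/-- **(5.2.2) ⇒ (5.9.2) in kernel form**, p. 296 *"bounds on φ and ψ − Q(u_k)φ imply … (5.9.2)"*: ON THE SUPPORT of the (5.2.2) factors
of the integrand — `χ_y ≠ 0` on `Λ₀′`, `χ_x ≠ 0` (radius parameter `λ_k^{−1/4}`, T10) on the blocks over `Λ₀′` and at the base points,
`χ_b ≠ 0` on the bonds of the contours — the typed leaf `Restr592 (2 + n_Γ) p(e_k) λ_k λ (L^kε) d Λ₀′ ψ` holds (model of §3).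
[cite: BalabanImbrieJaffe1988, (5.9.2) p.296] -/
theorem restr592_of_support (χ : CutoffProfile) {j' : ℕ} (u : PBond P j → ℂ) (hu : ∀ b, ‖u b‖ = 1)
    (φ : Balaban1983to89.Site P j → ℂ) (B : Balaban1983to89.Site P j' → Finset (Balaban1983to89.Site P j)) (w : ℝ) (hw : 0 ≤ w)
    (base : Balaban1983to89.Site P j' → Balaban1983to89.Site P j)
    (Γ : Balaban1983to89.Site P j' → Balaban1983to89.Site P j → Contour P j) (ψ : Balaban1983to89.Site P j' → ℂ)
    (Λ0' : Finset (Balaban1983to89.Site P j')) {pek lamk lam s : ℝ} {d nΓ : ℕ} (hpek : 0 < pek) (hs : 0 < s) (hs1 : s ≤ 1)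
    (hlamk : 0 < lamk) (hlamk1 : lamk ≤ 1) (hB : ∀ y ∈ Λ0', ((B y).card : ℝ) * w = 1)
    (hΓ : ∀ y ∈ Λ0', ∀ x ∈ B y, IsPath (base y) (Γ y x) x) (hlen : ∀ y ∈ Λ0', ∀ x ∈ B y, (Γ y x).length ≤ nΓ)
    (hY : ∀ y ∈ Λ0', chiY χ pek (ψ y) (covAvg B w (fun z x => transport u (Γ z x)) φ y) ≠ 0)
    (hX : ∀ y ∈ Λ0', ∀ x ∈ B y, chiX χ (lamk ^ (-(1 / 4 : ℝ))) pek s lam d (φ x) ≠ 0)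
    (hX₀ : ∀ y ∈ Λ0', chiX χ (lamk ^ (-(1 / 4 : ℝ))) pek s lam d (φ (base y)) ≠ 0)
    (hBd : ∀ y ∈ Λ0', ∀ x ∈ B y, ∀ sg ∈ Γ y x, chiB χ pek u φ sg.1 ≠ 0) :
    Restr592 (2 + nΓ) pek lamk lam s d Λ0' ψ := by
  have hr : 0 < lamk ^ (-(1 / 4 : ℝ)) := Real.rpow_pos_of_pos hlamk _
  exact restr592_of_restrictions u hu φ B w hw base Γ ψ Λ0' hpek.le hs hs1 hlamk hlamk1 hB hΓ hlen
    (fun y hy => (norm_sub_lt_of_chiY_ne_zero χ hpek (hY y hy)).le)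
    (fun hreg y hy x hx => (norm_lt_of_chiX_ne_zero χ hr hpek hreg (hX y hy x hx)).le)
    (fun hreg y hy => (abs_norm_sub_lt_of_chiX_ne_zero χ hs hpek hreg (hX₀ y hy)).le)
    (fun _ y hy x hx sg hsg => (norm_covD_lt_of_chiB_ne_zero χ hpek (hBd y hy x hx sg hsg)).le)

/-- the same from the NON-VANISHING OF THE PRODUCTS `Π χ_y · Π χ_x · Π χ_b` (the (5.2.7)-type factor `chi527` of the integrand (5.2.8)
restricted to the sites, blocks, base points and contour bonds over `Λ₀′`). [cite: BalabanImbrieJaffe1988, (5.9.2) p.296] -/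
theorem restr592_of_prod_ne_zero (χ : CutoffProfile) {j' : ℕ} (u : PBond P j → ℂ) (hu : ∀ b, ‖u b‖ = 1)
    (φ : Balaban1983to89.Site P j → ℂ) (B : Balaban1983to89.Site P j' → Finset (Balaban1983to89.Site P j)) (w : ℝ) (hw : 0 ≤ w)
    (base : Balaban1983to89.Site P j' → Balaban1983to89.Site P j)
    (Γ : Balaban1983to89.Site P j' → Balaban1983to89.Site P j → Contour P j) (ψ : Balaban1983to89.Site P j' → ℂ)
    (Λ0' : Finset (Balaban1983to89.Site P j')) {pek lamk lam s : ℝ} {d nΓ : ℕ} (hpek : 0 < pek) (hs : 0 < s) (hs1 : s ≤ 1)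
    (hlamk : 0 < lamk) (hlamk1 : lamk ≤ 1) (hB : ∀ y ∈ Λ0', ((B y).card : ℝ) * w = 1)
    (hΓ : ∀ y ∈ Λ0', ∀ x ∈ B y, IsPath (base y) (Γ y x) x) (hlen : ∀ y ∈ Λ0', ∀ x ∈ B y, (Γ y x).length ≤ nΓ)
    (hprod : chi527 (fun y => chiY χ pek (ψ y) (covAvg B w (fun z x => transport u (Γ z x)) φ y) *
        chiX χ (lamk ^ (-(1 / 4 : ℝ))) pek s lam d (φ (base y)) *
        ∏ x ∈ B y, (chiX χ (lamk ^ (-(1 / 4 : ℝ))) pek s lam d (φ x) * ((Γ y x).map fun sg => chiB χ pek u φ sg.1).prod)) Λ0' ≠ 0) :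
    Restr592 (2 + nΓ) pek lamk lam s d Λ0' ψ := by
  unfold chi527 at hprod
  rw [Finset.prod_ne_zero_iff] at hprod
  refine restr592_of_support χ u hu φ B w hw base Γ ψ Λ0' hpek hs hs1 hlamk hlamk1 hB hΓ hlen (fun y hy => ?_) (fun y hy x hx => ?_)
    (fun y hy => ?_) (fun y hy x hx sg hsg => ?_)
  · exact left_ne_zero_of_mul (left_ne_zero_of_mul (hprod y hy))
  · have h := (Finset.prod_ne_zero_iff.mp (right_ne_zero_of_mul (hprod y hy))) x hx
    exact left_ne_zero_of_mul h
  · exact right_ne_zero_of_mul (left_ne_zero_of_mul (hprod y hy))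
  · have h := right_ne_zero_of_mul ((Finset.prod_ne_zero_iff.mp (right_ne_zero_of_mul (hprod y hy))) x hx)
    intro h0
    exact h (List.prod_eq_zero (List.mem_map.mpr ⟨sg, hsg, h0⟩))

/-! ## §6 (v1.3, append-only) p. 296, the passage `ū_k → ū_{k+1}` inside the proof of (5.9.3): *"In going from u_k to u_{k+1} we
made a gauge transformation and removed some small fields. Also, the gauge transformation was not quite compensated by a rotation of ψ.
Thus in going from the old |D_{ū_k}ψ| to the new |D_{ū_{k+1}}ψ| we make errors of the order of ce_kp(e_k)³λ_k^{−1/4}, (L^kε)^d < λ or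
ce_kp(e_k)³(λ^{−1/2}(L^kε)^{(d−2)/2} + (L^kε)^{−1}), (L^kε)^d ≧ λ."* — the STRUCTURE of the error, kernel-checked: new ≤ old +
(defect of the bond variable) × (the (5.9.2) bound on ψ); the printed ORDERS are reproduced under the hypothesis `|ū_{k+1}(b) − ū_k(b)| ≤
c₁e_kp(e_k)²` on the uncompensated gauge defect (prose in print — TAKEN AS DATA, not derived here) -/

/-- `D_{u′}ψ(b) − D_uψ(b) = (u′(b) − u(b))ψ(b₊)`. [cite: BalabanImbrieJaffe1988, (5.9.3) p.296] -/
theorem covD_sub_covD (u u' : PBond P j → ℂ) (ψ : Balaban1983to89.Site P j → ℂ) (b : PBond P j) :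
    covD 1 u' ψ b - covD 1 u ψ b = (u' b - u b) * ψ b.tgt := by
  simp only [covD, Complex.ofReal_one, one_mul]
  ring

/-- `|D_{u′}ψ(b)| ≤ |D_uψ(b)| + |u′(b) − u(b)|·|ψ(b₊)|`. [cite: BalabanImbrieJaffe1988, (5.9.3) p.296] -/
theorem norm_covD_le_add_defect (u u' : PBond P j → ℂ) (ψ : Balaban1983to89.Site P j → ℂ) (b : PBond P j) :
    ‖covD 1 u' ψ b‖ ≤ ‖covD 1 u ψ b‖ + ‖u' b - u b‖ * ‖ψ b.tgt‖ := by
  have h : covD 1 u' ψ b = covD 1 u ψ b + (u' b - u b) * ψ b.tgt := by rw [← covD_sub_covD]; ring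
  rw [h]
  exact (norm_add_le _ _).trans (by rw [norm_mul])

/-- regime `(L^kε)^d < λ`: from (5.9.2) (`Restr592 c`), for a bond with `b₊ ∈ Λ₀′` and bond-variable defect `|ū′(b) − ū(b)| ≤ δ`,
`|D_{ū′}ψ(b)| ≤ |D_ūψ(b)| + δ·cp(e_k)λ_k^{−1/4}`. [cite: BalabanImbrieJaffe1988, (5.9.3) p.296] -/
theorem passage593_small {c pek lamk lam s δ : ℝ} {d : ℕ} {Λ0' : Finset (Balaban1983to89.Site P j)}
    {ψ : Balaban1983to89.Site P j → ℂ} (h592 : Restr592 c pek lamk lam s d Λ0' ψ) (hreg : s ^ d < lam)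
    (ubar ubar' : PBond P j → ℂ) {b : PBond P j} (hb : b.tgt ∈ Λ0') (hδ : ‖ubar' b - ubar b‖ ≤ δ) :
    ‖covD 1 ubar' ψ b‖ ≤ ‖covD 1 ubar ψ b‖ + δ * (c * pek * lamk ^ (-(1 / 4 : ℝ))) := by
  have hψ := h592.1 hreg _ hb
  have hδ0 : 0 ≤ δ := (norm_nonneg _).trans hδ
  refine (norm_covD_le_add_defect ubar ubar' ψ b).trans (add_le_add le_rfl ?_)
  exact (mul_le_mul_of_nonneg_right hδ (norm_nonneg _)).trans (mul_le_mul_of_nonneg_left hψ hδ0)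

/-- regime `(L^kε)^d ≥ λ`: from (5.9.2) (`Restr592 c`: `||ψ(y)| − ρ₀| ≤ cp(e_k)(L^kε)^{−1}`, so `|ψ(y)| ≤ ρ₀ + cp(e_k)(L^kε)^{−1}`),
`|D_{ū′}ψ(b)| ≤ |D_ūψ(b)| + δ·((8λ)^{−1/2}(L^kε)^{(d−2)/2} + cp(e_k)(L^kε)^{−1})`. [cite: BalabanImbrieJaffe1988, (5.9.3) p.296] -/
theorem passage593_large {c pek lamk lam s δ : ℝ} {d : ℕ} {Λ0' : Finset (Balaban1983to89.Site P j)}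
    {ψ : Balaban1983to89.Site P j → ℂ} (h592 : Restr592 c pek lamk lam s d Λ0' ψ) (hreg : lam ≤ s ^ d)
    (ubar ubar' : PBond P j → ℂ) {b : PBond P j} (hb : b.tgt ∈ Λ0') (hδ : ‖ubar' b - ubar b‖ ≤ δ) :
    ‖covD 1 ubar' ψ b‖ ≤ ‖covD 1 ubar ψ b‖ +
      δ * ((8 * lam) ^ (-(1 / 2 : ℝ)) * s ^ (((d : ℝ) - 2) / 2) + c * pek * s⁻¹) := by
  have hψ' := h592.2 hreg _ hb
  have hψ : ‖ψ b.tgt‖ ≤ (8 * lam) ^ (-(1 / 2 : ℝ)) * s ^ (((d : ℝ) - 2) / 2) + c * pek * s⁻¹ := by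
    have := (abs_le.mp hψ').2
    linarith
  have hδ0 : 0 ≤ δ := (norm_nonneg _).trans hδ
  refine (norm_covD_le_add_defect ubar ubar' ψ b).trans (add_le_add le_rfl ?_)
  exact (mul_le_mul_of_nonneg_right hδ (norm_nonneg _)).trans (mul_le_mul_of_nonneg_left hψ hδ0)

/-- THE PRINTED ORDERS: with the gauge defect `|ū_{k+1}(b) − ū_k(b)| ≤ c₁e_kp(e_k)²` (data), `p(e_k) ≥ 1`, the errors are
`≤ (c₁c)·e_kp(e_k)³λ_k^{−1/4}` for `(L^kε)^d < λ` and `≤ c₁(1 + c)·e_kp(e_k)³(λ^{−1/2}(L^kε)^{(d−2)/2} + (L^kε)^{−1})` for `(L^kε)^d ≥ λ` —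
*"errors of the order of ce_kp(e_k)³λ_k^{−1/4} … or ce_kp(e_k)³(λ^{−1/2}(L^kε)^{(d−2)/2} + (L^kε)^{−1})"*. [cite: BalabanImbrieJaffe1988, (5.9.3) p.296] -/
theorem passage593_order {c c₁ ek pek lamk lam s : ℝ} {d : ℕ} {Λ0' : Finset (Balaban1983to89.Site P j)}
    {ψ : Balaban1983to89.Site P j → ℂ} (h592 : Restr592 c pek lamk lam s d Λ0' ψ) (hc : 0 ≤ c) (hc₁ : 0 ≤ c₁) (hek : 0 ≤ ek)
    (hp : 1 ≤ pek) (hlam : 0 < lam) (hs : 0 < s) (ubar ubar' : PBond P j → ℂ) {b : PBond P j} (hb : b.tgt ∈ Λ0')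
    (hδ : ‖ubar' b - ubar b‖ ≤ c₁ * ek * pek ^ 2) :
    (s ^ d < lam → ‖covD 1 ubar' ψ b‖ ≤ ‖covD 1 ubar ψ b‖ + c₁ * c * ek * pek ^ 3 * lamk ^ (-(1 / 4 : ℝ))) ∧
      (lam ≤ s ^ d → ‖covD 1 ubar' ψ b‖ ≤ ‖covD 1 ubar ψ b‖ +
        c₁ * (1 + c) * ek * pek ^ 3 * (lam ^ (-(1 / 2 : ℝ)) * s ^ (((d : ℝ) - 2) / 2) + s⁻¹)) := by
  refine ⟨fun hreg => ?_, fun hreg => ?_⟩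
  · have h := passage593_small h592 hreg ubar ubar' hb hδ
    have : c₁ * ek * pek ^ 2 * (c * pek * lamk ^ (-(1 / 4 : ℝ))) = c₁ * c * ek * pek ^ 3 * lamk ^ (-(1 / 4 : ℝ)) := by ring
    linarith
  · have h := passage593_large h592 hreg ubar ubar' hb hδ
    set A : ℝ := s ^ (((d : ℝ) - 2) / 2) with hA
    have hA0 : 0 ≤ A := Real.rpow_nonneg hs.le _
    have hB0 : 0 ≤ s⁻¹ := (inv_pos.2 hs).le
    have h8 : (8 * lam) ^ (-(1 / 2 : ℝ)) ≤ lam ^ (-(1 / 2 : ℝ)) :=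
      Real.rpow_le_rpow_of_nonpos hlam (by linarith) (by norm_num)
    have hl0 : 0 ≤ lam ^ (-(1 / 2 : ℝ)) := Real.rpow_nonneg hlam.le _
    have hp0 : 0 ≤ pek := by linarith
    have hp23 : pek ^ 2 ≤ pek ^ 3 := pow_le_pow_right₀ hp (by norm_num)
    have hE : 0 ≤ c₁ * ek := mul_nonneg hc₁ hek
    -- first printed term
    have h1 : c₁ * ek * pek ^ 2 * ((8 * lam) ^ (-(1 / 2 : ℝ)) * A) ≤ c₁ * (1 + c) * ek * pek ^ 3 * (lam ^ (-(1 / 2 : ℝ)) * A) := by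
      have step1 : pek ^ 2 * ((8 * lam) ^ (-(1 / 2 : ℝ)) * A) ≤ pek ^ 3 * (lam ^ (-(1 / 2 : ℝ)) * A) :=
        mul_le_mul hp23 (mul_le_mul_of_nonneg_right h8 hA0) (mul_nonneg (Real.rpow_nonneg (by linarith) _) hA0)
          (pow_nonneg hp0 3)
      have step2 : c₁ * ek * (pek ^ 2 * ((8 * lam) ^ (-(1 / 2 : ℝ)) * A)) ≤ c₁ * ek * (pek ^ 3 * (lam ^ (-(1 / 2 : ℝ)) * A)) :=
        mul_le_mul_of_nonneg_left step1 hE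
      have step3 : c₁ * ek * (pek ^ 3 * (lam ^ (-(1 / 2 : ℝ)) * A)) ≤ c₁ * (1 + c) * ek * (pek ^ 3 * (lam ^ (-(1 / 2 : ℝ)) * A)) := by
        have hnn : 0 ≤ c₁ * ek * (pek ^ 3 * (lam ^ (-(1 / 2 : ℝ)) * A)) :=
          mul_nonneg hE (mul_nonneg (pow_nonneg hp0 3) (mul_nonneg hl0 hA0))
        nlinarith
      nlinarith
    -- second printed term
    have h2 : c₁ * ek * pek ^ 2 * (c * pek * s⁻¹) ≤ c₁ * (1 + c) * ek * pek ^ 3 * s⁻¹ := by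
      have : c₁ * ek * pek ^ 2 * (c * pek * s⁻¹) = c * (c₁ * ek * pek ^ 3 * s⁻¹) := by ring
      rw [this]
      have hnn : 0 ≤ c₁ * ek * pek ^ 3 * s⁻¹ := mul_nonneg (mul_nonneg hE (pow_nonneg hp0 3)) hB0
      nlinarith
    nlinarith

end Literature.MathematicalPhysics.QuantumFieldTheory.BalabanImbrieJaffe1984to88.BIJ88Restr592Proof
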